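import Summits.BirchSwinnertonDyer.BirchSwinnertonDyer.Theses.KolyvaginRankRigidityAtTwo
import Summits.BirchSwinnertonDyer.BirchSwinnertonDyer.Theorems.KolyvaginRankRigidityAtTwoKolyvaginCorankLowerBoundAtTwoDepthZero
import Summits.BirchSwinnertonDyer.BirchSwinnertonDyer.Theorems.KolyvaginRankRigidityAtTwoNoTwoTorsionOverK
import Summits.BirchSwinnertonDyer.BirchSwinnertonDyer.Theorems.KolyvaginRankRigidityAtTwoLevelTriangularSystem
import Summits.BirchSwinnertonDyer.BirchSwinnertonDyer.Theorems.KolyvaginRankRigidityAtTwoKolyvaginCorankLowerBoundAtTwoConjSign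
import Summits.BirchSwinnertonDyer.BirchSwinnertonDyer.Theorems.KolyvaginRankRigidityAtTwoKolyvaginCorankLowerBoundAtTwoLocalTrivialAtConductor
import Summits.BirchSwinnertonDyer.BirchSwinnertonDyer.Theorems.KolyvaginRankRigidityAtTwoKolyvaginCorankLowerBoundAtTwoSelmerAwayFromConductor
import Literature.NumberTheory.EllipticCurves.ArtinFormalismQuadraticLocalProofs
import HarnessLib

/-!
# TURNKEY (lead krr2-p1 g6) for the pen of route `KolyvaginRankRigidityAtTwo`: the twin
# `KolyvaginCorankLowerBoundAtTwo` ⇐ (Q2 `KolyvaginRelationAtTwo`) ∧ (T2) ∧ (T5⁺ window supply)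

Recommendation R3′ of LEAD-REPORT-g6, kernel-checked: V2♭ follows from
* GK2's item Q2 `Summit.….Theses.GenusKolyvaginAtTwo.KolyvaginRelationAtTwo` (stmt-24880), BY NAME
  (through the landed `stub_localTrivialAtConductor_of_kolyvaginRelationAtTwo`, p612374),
* the Selmer condition away from the conductor (T2, registered stub `stub_selmerAwayFromConductor`,
  claimed by krr2-p2; its text is the hypothesis `hT2all` below and disappears when it lands),
* the window supply at a strong depth (T5⁺, registered stub `stub_windowSupplyAtStrongDepth`; its
  text is the hypothesis `hWin` below — the proposed crux item `WindowSupplyAtStrongDepthAtTwo`),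
with the landed `stub_conjSign` (p611883), `stub_depthZero` (p606050), `noTwoTorsionOverK_proof` and
`lowerBound_of_levelTriangularSystems` (p610758). If the pen files the item texts below verbatim, this
file (minus `hT2all` once T2 lands) is the closing file of the twin. BSD is not proved by this; V2♭
itself stays open until Q2 and T5⁺ are theorems.
-/

set_option autoImplicit false
set_option linter.dupNamespace false

noncomputable section

open scoped Classical

open WeierstrassCurve Literature.NumberTheory.EllipticCurves
  Literature.NumberTheory.EllipticCurves.ModularForms NumberField IsDedekindDomain
open Summit.BirchSwinnertonDyer.BirchSwinnertonDyer.Theses.KolyvaginRankRigidityAtTwo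
open Summit.BirchSwinnertonDyer.BirchSwinnertonDyer.Theses.GenusKolyvaginAtTwo (KolyvaginRelationAtTwo)

namespace Summit.BirchSwinnertonDyer.BirchSwinnertonDyer.Theorems.KolyvaginLowerBoundAtTwo

/-- The prime factors of a product of distinct primes. [folklore] -/
private theorem primeFactors_prod_primes' {s : Finset ℕ} (hs : ∀ p ∈ s, p.Prime) :
    (∏ p ∈ s, p).primeFactors = s :=
  Nat.primeFactors_prod hs

/-- A product of distinct primes is square-free. [folklore] -/
private theorem squarefree_prod_primes' {s : Finset ℕ} (hs : ∀ p ∈ s, p.Prime) :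
    Squarefree (∏ p ∈ s, p) := by
  refine Finset.squarefree_prod_of_pairwise_isCoprime (fun a ha b hb hab ↦ ?_)
    fun p hp ↦ (hs p hp).squarefree
  simp only [← Nat.coprime_iff_isRelPrime]
  exact (Nat.coprime_primes (hs a ha) (hs b hb)).mpr hab

/-- **V2♭ at positive depth from Q2, T2 and the window supply** (the skeleton's `posDepth` with the
stubs T1 := p612374 ∘ Q2, T3 := p611883, and T2, T5⁺ as displayed hypotheses).
[cite: Kolyvagin1991MathAnn, §2 Thm. 2.2–2.3] -/
theorem posDepth_of_inputs (hQ2 : KolyvaginRelationAtTwo)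
    (hT2all :
    ∀ (W : WeierstrassCurve ℚ) [W.IsElliptic] [W.IsGloballyMinimal], ¬ W.HasCM →
      (Rank1Residual.GoodOrd W 2 ∨ Rank1Residual.Mult W 2) →
      (∀ m : ℕ, W.HasSurjectiveModNGaloisRep (2 ^ m : ℕ)) →
      ∀ (K : Type) [Field K] [NumberField K], IsImaginaryQuadratic K → NumberField.discr K ≠ -3 →
      NumberField.discr K ≠ -4 → ¬ ((2 : ℤ) ∣ NumberField.discr K) → ∀ [NeZero (W.conductorNorm ℤ)],
      SatisfiesHeegnerHypothesis (W.conductorNorm ℤ) K →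
      ∀ (Dt : ModularParametrizationData W (W.conductorNorm ℤ)) (β : ℤ) (ι : K →+* ℂ),
        ∃ t : ℕ, ∀ (n : ℕ) (d : KolyvaginHeegnerData Dt β ι n) (M : ℕ),
        KolyvaginDescent.KolSupp (Zhang2014.IsKolyvaginPrime (W.conductorNorm ℤ) W K 2) n →
        1 ≤ M → (M : ℕ∞) ≤ Zhang2014.levelIndex W 2 n →
        ∀ v : HeightOneSpectrum (𝓞 K), ((n : ℕ) : 𝓞 K) ∉ v.asIdeal →
          ((2 ^ t : ℕ) : ℤ) • d.kolyvaginClass Nat.prime_two M ∈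
            selmerLocalKer (W.baseChange K) (v.adicCompletion K) ((2 ^ M : ℕ) : ℤ))
    (hWin :
    ∀ (W : WeierstrassCurve ℚ) [W.IsElliptic] [W.IsGloballyMinimal], ¬ W.HasCM →
      (Rank1Residual.GoodOrd W 2 ∨ Rank1Residual.Mult W 2) →
      (∀ m : ℕ, W.HasSurjectiveModNGaloisRep (2 ^ m : ℕ)) →
      ∀ (K : Type) [Field K] [NumberField K], IsImaginaryQuadratic K → NumberField.discr K ≠ -3 →
      NumberField.discr K ≠ -4 → ¬ ((2 : ℤ) ∣ NumberField.discr K) → ∀ [NeZero (W.conductorNorm ℤ)],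
      SatisfiesHeegnerHypothesis (W.conductorNorm ℤ) K →
      ∀ (Dt : ModularParametrizationData W (W.conductorNorm ℤ)) (β : ℤ) (ι : K →+* ℂ) (ν : ℕ),
        1 ≤ ν →
        (∃ (n₀ : ℕ) (d₀ : KolyvaginHeegnerData Dt β ι n₀) (M₀ : ℕ),
          KolyvaginDescent.KolSupp (Zhang2014.IsKolyvaginPrime (W.conductorNorm ℤ) W K 2) n₀ ∧
          n₀.primeFactors.card = ν ∧ 1 ≤ M₀ ∧ (M₀ : ℕ∞) ≤ Zhang2014.levelIndex W 2 n₀ ∧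
          d₀.kolyvaginClass Nat.prime_two M₀ ≠ 0) →
        (∀ (n' : ℕ) (d' : KolyvaginHeegnerData Dt β ι n') (M' : ℕ),
          KolyvaginDescent.KolSupp (Zhang2014.IsKolyvaginPrime (W.conductorNorm ℤ) W K 2) n' →
          1 ≤ M' → (M' : ℕ∞) ≤ Zhang2014.levelIndex W 2 n' → n'.primeFactors.card < ν →
          d'.kolyvaginClass Nat.prime_two M' = 0) →
        ∃ f dd : ℕ, ν ≤ f ∧ ∀ M : ℕ, 1 ≤ M →
          ∃ (S : Fin (f + 1) → Finset ℕ) (q : Fin (f + 1) → ℕ)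
            (v : Fin (f + 1) → HeightOneSpectrum (𝓞 K))
            (dat : (i : Fin (f + 1)) → KolyvaginHeegnerData Dt β ι (∏ p ∈ S i, p)),
            (∀ i, (S i).card = f) ∧
            (∀ i, ∀ p ∈ S i, Zhang2014.IsKolyvaginPrime (W.conductorNorm ℤ) W K 2 p ∧
              M + 1 ≤ Zhang2014.kolyvaginIndex W 2 p) ∧
            (∀ i j : Fin (f + 1), j < i → q j ∈ S i) ∧
            (∀ i, ((q i : ℕ) : 𝓞 K) ∈ (v i).asIdeal) ∧
            (∀ i, ∀ ℓ ∈ S i, ∀ d₀ : KolyvaginHeegnerData Dt β ι ((∏ p ∈ S i, p) / ℓ),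
                d₀.kolyvaginClass Nat.prime_two M = 0) ∧
            (∀ (i : Fin (f + 1)) (e : ℕ), e + dd < M →
              ((2 ^ e : ℕ) : ℤ) • (dat i).kolyvaginClass Nat.prime_two M ∉
                (W.baseChange K).torsionLocalKer ((v i).adicCompletion K) ((2 ^ M : ℕ) : ℤ))) :
    ∀ (W : WeierstrassCurve ℚ) [W.IsElliptic] [W.IsGloballyMinimal], ¬ W.HasCM →
      (Rank1Residual.GoodOrd W 2 ∨ Rank1Residual.Mult W 2) →
      (∀ m : ℕ, W.HasSurjectiveModNGaloisRep (2 ^ m : ℕ)) →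
      ∀ (K : Type) [Field K] [NumberField K], IsImaginaryQuadratic K → NumberField.discr K ≠ -3 →
      NumberField.discr K ≠ -4 → ¬ ((2 : ℤ) ∣ NumberField.discr K) → ∀ [NeZero (W.conductorNorm ℤ)],
      SatisfiesHeegnerHypothesis (W.conductorNorm ℤ) K →
      ∀ (Dt : ModularParametrizationData W (W.conductorNorm ℤ)) (β : ℤ) (ι : K →+* ℂ) (n : ℕ)
        (d : KolyvaginHeegnerData Dt β ι n) (M : ℕ),
        KolyvaginDescent.KolSupp (Zhang2014.IsKolyvaginPrime (W.conductorNorm ℤ) W K 2) n →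
        1 ≤ M → (M : ℕ∞) ≤ Zhang2014.levelIndex W 2 n → d.kolyvaginClass Nat.prime_two M ≠ 0 →
        (∀ (n' : ℕ) (d' : KolyvaginHeegnerData Dt β ι n') (M' : ℕ),
          KolyvaginDescent.KolSupp (Zhang2014.IsKolyvaginPrime (W.conductorNorm ℤ) W K 2) n' →
          1 ≤ M' → (M' : ℕ∞) ≤ Zhang2014.levelIndex W 2 n' → d'.kolyvaginClass Nat.prime_two M' ≠ 0 →
          n.primeFactors.card ≤ n'.primeFactors.card) →
        0 < n.primeFactors.card →
        (n.primeFactors.card + 1 ≤ W.selmerCorank 2 ∨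
          n.primeFactors.card + 1 ≤ (W.quadraticTwist (NumberField.discr K : ℚ)).selmerCorank 2) := by
  intro W _ _ hCM hred hsur K _ _ hK hne3 hne4 h2d _ hHN Dt β ι n d M hn hM1 hMle hne hmin hpos
  set N := W.conductorNorm ℤ with hNdef
  set ν := n.primeFactors.card with hνdef
  haveI : Fact (Nat.Prime 2) := ⟨Nat.prime_two⟩
  -- minimality, contrapositive form
  have hmin' : ∀ (n' : ℕ) (d' : KolyvaginHeegnerData Dt β ι n') (M' : ℕ),
      KolyvaginDescent.KolSupp (Zhang2014.IsKolyvaginPrime N W K 2) n' →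
      1 ≤ M' → (M' : ℕ∞) ≤ Zhang2014.levelIndex W 2 n' → n'.primeFactors.card < ν →
      d'.kolyvaginClass Nat.prime_two M' = 0 := by
    intro n' d' M' hn' hM1' hMle' hlt
    by_contra hne'
    exact absurd (hmin n' d' M' hn' hM1' hMle' hne') (not_le.mpr hlt)
  -- the quadratic field: `K = ℚ(θ)`, `θ² = d_K`, `σ₀` its non-trivial automorphism
  obtain ⟨θ, hθ, hc⟩ := exists_sq_eq_discr_not_mem_range K hK.1
  set σ₀ := sigmaQ K hK.1 hθ hc with hσ₀
  have hσ₀1 : σ₀ ≠ 1 := sigmaQ_ne_one K hK.1 hθ hc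
  -- the stubs, instantiated on this frame; `f` = the strong depth supplied by T5⁺
  have hT1 := stub_localTrivialAtConductor_of_kolyvaginRelationAtTwo hQ2 W hCM hred hsur K hK hne3 hne4 h2d hHN Dt β ι
  obtain ⟨t, hT2⟩ := hT2all W hCM hred hsur K hK hne3 hne4 h2d hHN Dt β ι
  obtain ⟨f, dd, hνf, hT5⟩ := hWin W hCM hred hsur K hK hne3 hne4 h2d hHN
    Dt β ι ν hpos ⟨n, d, M, hn, rfl, hM1, hMle, hne⟩ hmin'
  obtain ⟨ε, hε1, hT3⟩ := stub_conjSign W hCM hred hsur K hK hne3 hne4 h2d hHN Dt β ι σ₀ hσ₀1 f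
  -- `E(K)[2] = 0` (landed support `NoTwoTorsionOverK`)
  have htor : AddSubgroup.torsionBy (W.baseChange K).toAffine.Point (2 : ℤ) = ⊥ :=
    KolyvaginRankRigidity.noTwoTorsionOverK_proof W hsur K hK
  -- it suffices to bound by `f + 1 ≥ ν + 1`
  suffices h : f + 1 ≤ W.selmerCorank 2 ∨
      f + 1 ≤ (W.quadraticTwist (NumberField.discr K : ℚ)).selmerCorank 2 by
    rcases h with h | h
    · exact Or.inl (le_trans (by omega) h)
    · exact Or.inr (le_trans (by omega) h)
  -- the level-`2^M'` triangular systems at depth `f`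
  refine lowerBound_of_levelTriangularSystems W K hK.1 hθ hc htor f (dd + t) ε hε1 fun M' ↦ ?_
  rcases Nat.eq_zero_or_pos M' with hM'0 | hM'pos
  · subst hM'0
    obtain ⟨-, -, v₁, -, -⟩ := hT5 1 le_rfl
    refine ⟨fun _ ↦ 0, v₁, fun _ ↦ zero_mem _, fun _ ↦ by rw [map_zero, zsmul_zero],
      fun _ _ _ ↦ zero_mem _, fun _ e he ↦ absurd he (by omega)⟩
  obtain ⟨S, q, v, dat, hcard, hprimes, hinc, hqv, hvan0, hdiag⟩ := hT5 M' hM'pos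
  -- facts on the window conductors
  have hSprime : ∀ i, ∀ p ∈ S i, p.Prime := fun i p hp ↦ (hprimes i p hp).1.1
  have hpf : ∀ i, (∏ p ∈ S i, p).primeFactors = S i := fun i ↦ primeFactors_prod_primes' (hSprime i)
  have hsupp : ∀ i, KolyvaginDescent.KolSupp (Zhang2014.IsKolyvaginPrime N W K 2) (∏ p ∈ S i, p) :=
    fun i ↦ ⟨squarefree_prod_primes' (hSprime i), fun p hp ↦ (hprimes i p (by rwa [hpf i] at hp)).1⟩
  have hlev1 : ∀ i, ((M' + 1 : ℕ) : ℕ∞) ≤ Zhang2014.levelIndex W 2 (∏ p ∈ S i, p) := fun i ↦ by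
    rw [Zhang2014.natCast_le_levelIndex_iff]
    intro p hp
    rw [hpf i] at hp
    exact (hprimes i p hp).2
  have hlev : ∀ i, ((M' : ℕ) : ℕ∞) ≤ Zhang2014.levelIndex W 2 (∏ p ∈ S i, p) := fun i ↦
    le_trans (by exact_mod_cast Nat.le_succ M') (hlev1 i)
  -- T1 at every prime `ℓ ∣ n_i` (vanishing of the classes of conductor `n_i/ℓ` supplied by T5⁺)
  have hloc : ∀ i, ∀ ℓ ∈ S i, ∀ w : HeightOneSpectrum (𝓞 K), ((ℓ : ℕ) : 𝓞 K) ∈ w.asIdeal →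
      (dat i).kolyvaginClass Nat.prime_two M' ∈
        (W.baseChange K).torsionLocalKer (w.adicCompletion K) ((2 ^ M' : ℕ) : ℤ) :=
    fun i ℓ hℓ w hw ↦ hT1 _ (dat i) M' ℓ (hsupp i) hM'pos (hlev1 i) (by rw [hpf i]; exact hℓ)
      (hvan0 i ℓ hℓ) w hw
  -- the classes
  refine ⟨fun i ↦ ((2 ^ t : ℕ) : ℤ) • (dat i).kolyvaginClass Nat.prime_two M', v, ?_, ?_, ?_, ?_⟩
  · -- Selmer
    intro i
    rw [mem_selmerGroup_iff]
    refine ⟨fun w ↦ ?_, fun w ↦ ?_⟩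
    · by_cases hw : (((∏ p ∈ S i, p : ℕ) : ℕ) : 𝓞 K) ∈ w.asIdeal
      · rw [Nat.cast_prod] at hw
        obtain ⟨ℓ, hℓ, hℓw⟩ := Ideal.IsPrime.prod_mem_iff.mp hw
        exact AddSubgroup.zsmul_mem _
          ((W.baseChange K).torsionLocalKer_le_selmerLocalKer _ _ (hloc i ℓ hℓ w hℓw)) _
      · exact hT2 _ (dat i) M' (hsupp i) hM'pos (hlev i) w hw
    · haveI : IsAlgClosed w.Completion := isAlgClosed_of_ringEquiv
        (InfinitePlace.Completion.ringEquivComplexOfIsComplex (hK.2.isComplex w)).symm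
      rw [WeierstrassCurve.selmerLocalKer_eq_top_of_isAlgClosed]
      trivial
  · -- eigen
    intro i
    rw [map_zsmul, hT3 _ (dat i) M' (hsupp i) (by rw [hpf i, hcard i]) hM'pos (hlev i),
      smul_comm]
  · -- triangular
    intro i j hij
    exact AddSubgroup.zsmul_mem _ (hloc i (q j) (hinc i j hij) (v j) (hqv j)) _
  · -- diagonal
    intro i e he hmem
    refine hdiag i (e + t) (by omega) ?_
    rw [pow_add, Nat.cast_mul, ← smul_smul]
    exact hmem


/-- **The twin: V2♭ `KolyvaginCorankLowerBoundAtTwo` from Q2 (by name), T2 and the window supply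
T5⁺.** Depth `0` is the landed `stub_depthZero`. This is recommendation R3′: with items
`KolyvaginRelationAtTwo` (= 24880 by name) and `WindowSupplyAtStrongDepthAtTwo` (text of `hWin`)
filed on the route, and T2 landed, the twin `… → … → KolyvaginCorankLowerBoundAtTwo` closes by
this proof. [cite: Kolyvagin1991MathAnn, §2 Thm. 2.2–2.3] -/
theorem kolyvaginCorankLowerBoundAtTwo_of_inputs (hQ2 : KolyvaginRelationAtTwo)
    (hT2all :
    ∀ (W : WeierstrassCurve ℚ) [W.IsElliptic] [W.IsGloballyMinimal], ¬ W.HasCM →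
      (Rank1Residual.GoodOrd W 2 ∨ Rank1Residual.Mult W 2) →
      (∀ m : ℕ, W.HasSurjectiveModNGaloisRep (2 ^ m : ℕ)) →
      ∀ (K : Type) [Field K] [NumberField K], IsImaginaryQuadratic K → NumberField.discr K ≠ -3 →
      NumberField.discr K ≠ -4 → ¬ ((2 : ℤ) ∣ NumberField.discr K) → ∀ [NeZero (W.conductorNorm ℤ)],
      SatisfiesHeegnerHypothesis (W.conductorNorm ℤ) K →
      ∀ (Dt : ModularParametrizationData W (W.conductorNorm ℤ)) (β : ℤ) (ι : K →+* ℂ),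
        ∃ t : ℕ, ∀ (n : ℕ) (d : KolyvaginHeegnerData Dt β ι n) (M : ℕ),
        KolyvaginDescent.KolSupp (Zhang2014.IsKolyvaginPrime (W.conductorNorm ℤ) W K 2) n →
        1 ≤ M → (M : ℕ∞) ≤ Zhang2014.levelIndex W 2 n →
        ∀ v : HeightOneSpectrum (𝓞 K), ((n : ℕ) : 𝓞 K) ∉ v.asIdeal →
          ((2 ^ t : ℕ) : ℤ) • d.kolyvaginClass Nat.prime_two M ∈
            selmerLocalKer (W.baseChange K) (v.adicCompletion K) ((2 ^ M : ℕ) : ℤ))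
    (hWin :
    ∀ (W : WeierstrassCurve ℚ) [W.IsElliptic] [W.IsGloballyMinimal], ¬ W.HasCM →
      (Rank1Residual.GoodOrd W 2 ∨ Rank1Residual.Mult W 2) →
      (∀ m : ℕ, W.HasSurjectiveModNGaloisRep (2 ^ m : ℕ)) →
      ∀ (K : Type) [Field K] [NumberField K], IsImaginaryQuadratic K → NumberField.discr K ≠ -3 →
      NumberField.discr K ≠ -4 → ¬ ((2 : ℤ) ∣ NumberField.discr K) → ∀ [NeZero (W.conductorNorm ℤ)],
      SatisfiesHeegnerHypothesis (W.conductorNorm ℤ) K →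
      ∀ (Dt : ModularParametrizationData W (W.conductorNorm ℤ)) (β : ℤ) (ι : K →+* ℂ) (ν : ℕ),
        1 ≤ ν →
        (∃ (n₀ : ℕ) (d₀ : KolyvaginHeegnerData Dt β ι n₀) (M₀ : ℕ),
          KolyvaginDescent.KolSupp (Zhang2014.IsKolyvaginPrime (W.conductorNorm ℤ) W K 2) n₀ ∧
          n₀.primeFactors.card = ν ∧ 1 ≤ M₀ ∧ (M₀ : ℕ∞) ≤ Zhang2014.levelIndex W 2 n₀ ∧
          d₀.kolyvaginClass Nat.prime_two M₀ ≠ 0) →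
        (∀ (n' : ℕ) (d' : KolyvaginHeegnerData Dt β ι n') (M' : ℕ),
          KolyvaginDescent.KolSupp (Zhang2014.IsKolyvaginPrime (W.conductorNorm ℤ) W K 2) n' →
          1 ≤ M' → (M' : ℕ∞) ≤ Zhang2014.levelIndex W 2 n' → n'.primeFactors.card < ν →
          d'.kolyvaginClass Nat.prime_two M' = 0) →
        ∃ f dd : ℕ, ν ≤ f ∧ ∀ M : ℕ, 1 ≤ M →
          ∃ (S : Fin (f + 1) → Finset ℕ) (q : Fin (f + 1) → ℕ)
            (v : Fin (f + 1) → HeightOneSpectrum (𝓞 K))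
            (dat : (i : Fin (f + 1)) → KolyvaginHeegnerData Dt β ι (∏ p ∈ S i, p)),
            (∀ i, (S i).card = f) ∧
            (∀ i, ∀ p ∈ S i, Zhang2014.IsKolyvaginPrime (W.conductorNorm ℤ) W K 2 p ∧
              M + 1 ≤ Zhang2014.kolyvaginIndex W 2 p) ∧
            (∀ i j : Fin (f + 1), j < i → q j ∈ S i) ∧
            (∀ i, ((q i : ℕ) : 𝓞 K) ∈ (v i).asIdeal) ∧
            (∀ i, ∀ ℓ ∈ S i, ∀ d₀ : KolyvaginHeegnerData Dt β ι ((∏ p ∈ S i, p) / ℓ),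
                d₀.kolyvaginClass Nat.prime_two M = 0) ∧
            (∀ (i : Fin (f + 1)) (e : ℕ), e + dd < M →
              ((2 ^ e : ℕ) : ℤ) • (dat i).kolyvaginClass Nat.prime_two M ∉
                (W.baseChange K).torsionLocalKer ((v i).adicCompletion K) ((2 ^ M : ℕ) : ℤ))) :
    KolyvaginCorankLowerBoundAtTwo := by
  intro W _ _ hCM hred hsur K _ _ hK hne3 hne4 h2d _ hHN Dt β ι n d M hn hM1 hMle hne hmin
  rcases Nat.eq_zero_or_pos n.primeFactors.card with h0 | hpos
  · exact stub_depthZero W hCM hred hsur K hK hne3 hne4 h2d hHN Dt β ι n d M hn hM1 hMle hne hmin h0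
  · exact posDepth_of_inputs hQ2 hT2all hWin W hCM hred hsur K hK hne3 hne4 h2d hHN Dt β ι n d M hn
      hM1 hMle hne hmin hpos

/-- **The twin in its final shape: V2♭ from Q2 (by name) and the window supply T5⁺ only** — T2 is now
the LANDED `KolyvaginRankRigidity.stub_selmerAwayFromConductor` (p612348, krr2-p2). Recommendation
R3′: file items `KolyvaginRelationAtTwo` (= 24880 by name) and `WindowSupplyAtStrongDepthAtTwo`
(text of `hWin`); this theorem closes their twin `… → … → KolyvaginCorankLowerBoundAtTwo`.
[cite: Kolyvagin1991MathAnn, §2 Thm. 2.2–2.3] -/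
theorem kolyvaginCorankLowerBoundAtTwo_of_Q2_of_windows (hQ2 : KolyvaginRelationAtTwo)
    (hWin :
    ∀ (W : WeierstrassCurve ℚ) [W.IsElliptic] [W.IsGloballyMinimal], ¬ W.HasCM →
      (Rank1Residual.GoodOrd W 2 ∨ Rank1Residual.Mult W 2) →
      (∀ m : ℕ, W.HasSurjectiveModNGaloisRep (2 ^ m : ℕ)) →
      ∀ (K : Type) [Field K] [NumberField K], IsImaginaryQuadratic K → NumberField.discr K ≠ -3 →
      NumberField.discr K ≠ -4 → ¬ ((2 : ℤ) ∣ NumberField.discr K) → ∀ [NeZero (W.conductorNorm ℤ)],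
      SatisfiesHeegnerHypothesis (W.conductorNorm ℤ) K →
      ∀ (Dt : ModularParametrizationData W (W.conductorNorm ℤ)) (β : ℤ) (ι : K →+* ℂ) (ν : ℕ),
        1 ≤ ν →
        (∃ (n₀ : ℕ) (d₀ : KolyvaginHeegnerData Dt β ι n₀) (M₀ : ℕ),
          KolyvaginDescent.KolSupp (Zhang2014.IsKolyvaginPrime (W.conductorNorm ℤ) W K 2) n₀ ∧
          n₀.primeFactors.card = ν ∧ 1 ≤ M₀ ∧ (M₀ : ℕ∞) ≤ Zhang2014.levelIndex W 2 n₀ ∧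
          d₀.kolyvaginClass Nat.prime_two M₀ ≠ 0) →
        (∀ (n' : ℕ) (d' : KolyvaginHeegnerData Dt β ι n') (M' : ℕ),
          KolyvaginDescent.KolSupp (Zhang2014.IsKolyvaginPrime (W.conductorNorm ℤ) W K 2) n' →
          1 ≤ M' → (M' : ℕ∞) ≤ Zhang2014.levelIndex W 2 n' → n'.primeFactors.card < ν →
          d'.kolyvaginClass Nat.prime_two M' = 0) →
        ∃ f dd : ℕ, ν ≤ f ∧ ∀ M : ℕ, 1 ≤ M →
          ∃ (S : Fin (f + 1) → Finset ℕ) (q : Fin (f + 1) → ℕ)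
            (v : Fin (f + 1) → HeightOneSpectrum (𝓞 K))
            (dat : (i : Fin (f + 1)) → KolyvaginHeegnerData Dt β ι (∏ p ∈ S i, p)),
            (∀ i, (S i).card = f) ∧
            (∀ i, ∀ p ∈ S i, Zhang2014.IsKolyvaginPrime (W.conductorNorm ℤ) W K 2 p ∧
              M + 1 ≤ Zhang2014.kolyvaginIndex W 2 p) ∧
            (∀ i j : Fin (f + 1), j < i → q j ∈ S i) ∧
            (∀ i, ((q i : ℕ) : 𝓞 K) ∈ (v i).asIdeal) ∧
            (∀ i, ∀ ℓ ∈ S i, ∀ d₀ : KolyvaginHeegnerData Dt β ι ((∏ p ∈ S i, p) / ℓ),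
                d₀.kolyvaginClass Nat.prime_two M = 0) ∧
            (∀ (i : Fin (f + 1)) (e : ℕ), e + dd < M →
              ((2 ^ e : ℕ) : ℤ) • (dat i).kolyvaginClass Nat.prime_two M ∉
                (W.baseChange K).torsionLocalKer ((v i).adicCompletion K) ((2 ^ M : ℕ) : ℤ))) :
    KolyvaginCorankLowerBoundAtTwo :=
  kolyvaginCorankLowerBoundAtTwo_of_inputs hQ2 KolyvaginRankRigidity.stub_selmerAwayFromConductor hWin

end Summit.BirchSwinnertonDyer.BirchSwinnertonDyer.Theorems.KolyvaginLowerBoundAtTwo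

end
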